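import Summits.AtomisticToContinuum.HydrodynamicLimit.Theorems.LambertianContactSwapLambertianEulerRestartInLaw
import Summits.AtomisticToContinuum.HydrodynamicLimit.Theorems.LambertianContactSwapLambertianEulerWindowCocycle
import Summits.AtomisticToContinuum.HydrodynamicLimit.Theorems.LambertianContactSwapLambertianEulerLiouville
import Literature.MathematicalPhysics.KineticTheory.HardSphereEulerProofs
import HarnessLib

/-!
# `LambertianEuler` (stmt-AtomisticToContinuum-11854), line `Sketch`: stationarity in law of the
# increments of the Lambertian collision count at equilibrium

Registered sub-goal `lambertCount_increment_law` (E1 of lead c9) of the `N`-uniform equilibrium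
collision rate of the Lambertian hard-sphere gas on `𝕋³` (`N + 1` spheres of diameter
`ε = hsDiameter σ N`, `0 < σ < 1/2`).  Write `K_t(z; ξs) = lambertCount` for the number of Lambertian
collisions in `[0, t]` of the trajectory from `z` driven by the i.i.d. Gaussian redraws `ξs ∼ γ^ℕ`,
`Λ_t = lambertFlow`, and `μ := G_N ⊗ γ^ℕ` for the Gibbs law `G_N = localGibbsLaw σ b w ϑ N Φ` with
CONSTANT profiles `b, ϑ > 0`, `w`.  Then for `s, h ≥ 0` and every `k : ℕ`,

  `μ {k + K_s ≤ K_{s+h}} = μ {k ≤ K_h}`: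

at equilibrium the window increment `K_{s+h} − K_s` has the law of `K_h`.

## Proof

* `G_N ≪ liouville` (`localGibbsLaw_eq`, `localGibbsMeasure_absolutelyContinuous`), so `μ`-a.e. the
  collision instants do not accumulate (`…RestartInLaw.ae_nonAccumulation_of_absolutelyContinuous`) and
  the window cocycle `…WindowCocycle.count_window_eq_restart` gives
  `K_{s+h} = K_s + K_h ∘ restart_s` with `restart_s(z, ξs) = (Λ_s(z; ξs), ξs (· + K_s(z; ξs)))`; hence
  `{k + K_s ≤ K_{s+h}} =ᵐ[μ] restart_s⁻¹' {k ≤ K_h}` (`measure_congr`).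
* The law of the restarted pair is `(μ ∘ Λ_s⁻¹) ⊗ γ^ℕ` (the strong Markov identity in law
  `…RestartInLaw.map_lambertRestart_eq`, i.e. R1 `lintegral_restart_eq` on indicators), and
  `μ ∘ Λ_s⁻¹ = G_N` (`…Liouville.gibbsInvarianceLambda_holds`), so
  `μ (restart_s⁻¹' {k ≤ K_h}) = (G_N ⊗ γ^ℕ) {k ≤ K_h} = μ {k ≤ K_h}` (`Measure.map_apply`, the event
  being measurable by `measurable_lambertCount`).

All [folklore] given the cited landed files (the strong Markov property of i.i.d. redraws read at a
stopping index, and stationarity of the equilibrium law).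
-/

noncomputable section

namespace Summit.AtomisticToContinuum.HydrodynamicLimit.Theorems.LambertianContactSwapLambertianEulerEquilibriumCountStationarity

open scoped BigOperators Topology ENNReal InnerProductSpace
open MeasureTheory ProbabilityTheory Filter Set InformationTheory
open Literature.MathematicalPhysics.KineticTheory
open Literature.Analysis.FluidPDE Literature.Analysis.FluidPDE.Alexander
open Summit.AtomisticToContinuum.HydrodynamicLimit.Theorems.LambertianContactSwapLambertianEulerRestartInLaw
open Summit.AtomisticToContinuum.HydrodynamicLimit.Theorems.LambertianContactSwapLambertianEulerWindowCocycle
open Summit.AtomisticToContinuum.HydrodynamicLimit.Theorems.LambertianContactSwapLambertianEulerLiouville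

/-- **The Gibbs law with constant profiles is a probability measure** for `σ < 1/2`, `b, ϑ > 0`
(`isProbabilityMeasure_localGibbsLaw` with constant, hence continuous, profiles). [folklore] -/
theorem isProbabilityMeasure_localGibbsLaw_const {σ : ℝ} (hσ' : σ < 2⁻¹) (N : ℕ) {b ϑ : ℝ} (w : V3)
    (hb : 0 < b) (hϑ : 0 < ϑ) (Φ : HardSphereFlow (Torus.geometry (Fin 3)) (hsDiameter σ N) (N + 1)) :
    IsProbabilityMeasure (localGibbsLaw σ (fun _ => b) (fun _ => w) (fun _ => ϑ) N Φ) :=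
  isProbabilityMeasure_localGibbsLaw continuous_const continuous_const continuous_const (fun _ => hb)
    (fun _ => hϑ) (by rw [one_div]; exact hσ'.le) N Φ

/-- **The Gibbs law is absolutely continuous with respect to the Liouville measure** (it is the Liouville
measure with the canonical density: `localGibbsLaw_eq`, `localGibbsMeasure_absolutelyContinuous`).
[folklore] -/
theorem localGibbsLaw_absolutelyContinuous (σ : ℝ) (a₀ : T3 → ℝ) (u₀ : T3 → V3) (θ₀ : T3 → ℝ) (N : ℕ)
    (Φ : HardSphereFlow (Torus.geometry (Fin 3)) (hsDiameter σ N) (N + 1)) :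
    localGibbsLaw σ a₀ u₀ θ₀ N Φ ≪ liouville (Torus.geometry (Fin 3)) (N + 1) (hsDiameter σ N) := by
  rw [localGibbsLaw_eq]
  exact localGibbsMeasure_absolutelyContinuous σ a₀ u₀ θ₀ N Φ

/-- **The window count is a.e. the count of the restarted pair**: for `0 < σ < 1/2`, an initial law
`P ≪ liouville` on `𝕋³`, `s, h ≥ 0` and `k : ℕ`, the events `{k + K_s ≤ K_{s+h}}` and
`{k ≤ K_h(Λ_s, ξs (· + K_s))}` agree `P ⊗ γ^ℕ`-a.e. (off the null accumulation set,
`ae_nonAccumulation_of_absolutelyContinuous`, the cocycle `count_window_eq_restart` reads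
`K_{s+h} = K_s + K_h ∘ restart_s`). [folklore] -/
theorem setOf_window_ae_eq_preimage_restart : ∀ {σ : ℝ}, 0 < σ → σ < 2⁻¹ → ∀ (N : ℕ)
    (P : Measure (Config (N + 1) (Fin 3) T3)),
    P ≪ liouville (Torus.geometry (Fin 3)) (N + 1) (hsDiameter σ N) → ∀ {s h : ℝ}, 0 ≤ s → 0 ≤ h → ∀ k : ℕ,
    ({p | k + lambertCount (Torus.geometry (Fin 3)) (hsDiameter σ N) p.2 p.1 s ≤
        lambertCount (Torus.geometry (Fin 3)) (hsDiameter σ N) p.2 p.1 (s + h)} :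
          Set (Config (N + 1) (Fin 3) T3 × (ℕ → V3))) =ᵐ[P.prod (lambertNoise (Fin 3))]
      ((fun p : Config (N + 1) (Fin 3) T3 × (ℕ → V3) =>
          (lambertFlow (Torus.geometry (Fin 3)) (hsDiameter σ N) p.2 p.1 s,
            fun n => p.2 (n + lambertCount (Torus.geometry (Fin 3)) (hsDiameter σ N) p.2 p.1 s))) ⁻¹'
        {q | k ≤ lambertCount (Torus.geometry (Fin 3)) (hsDiameter σ N) q.2 q.1 h}) := by
  intro σ hσ hσ' N P hP s h hs hh k
  filter_upwards [ae_nonAccumulation_of_absolutelyContinuous hσ hσ' N P hP] with p hp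
  refine propext ?_
  show k + lambertCount (Torus.geometry (Fin 3)) (hsDiameter σ N) p.2 p.1 s ≤
      lambertCount (Torus.geometry (Fin 3)) (hsDiameter σ N) p.2 p.1 (s + h) ↔
    k ≤ lambertCount (Torus.geometry (Fin 3)) (hsDiameter σ N)
      (fun n => p.2 (n + lambertCount (Torus.geometry (Fin 3)) (hsDiameter σ N) p.2 p.1 s))
      (lambertFlow (Torus.geometry (Fin 3)) (hsDiameter σ N) p.2 p.1 s) h
  rw [count_window_eq_restart hs hh (hp s) (hp (s + h))]
  omega

/-- **Restart in law of count events**: for `0 < σ < 1/2`, a finite initial law `P ≪ liouville` on `𝕋³`,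
`s, h ≥ 0` and `k : ℕ`, `(P ⊗ γ^ℕ) {k + K_s ≤ K_{s+h}} = (μ_s ⊗ γ^ℕ) {k ≤ K_h}` with
`μ_s = (P ⊗ γ^ℕ) ∘ Λ_s⁻¹` the law of the state at time `s` (`setOf_window_ae_eq_preimage_restart`,
`Measure.map_apply` and the strong Markov identity in law `map_lambertRestart_eq`). [folklore] -/
theorem measure_setOf_window_eq_map : ∀ {σ : ℝ}, 0 < σ → σ < 2⁻¹ → ∀ (N : ℕ)
    (P : Measure (Config (N + 1) (Fin 3) T3)) [IsFiniteMeasure P],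
    P ≪ liouville (Torus.geometry (Fin 3)) (N + 1) (hsDiameter σ N) → ∀ {s h : ℝ}, 0 ≤ s → 0 ≤ h → ∀ k : ℕ,
    (P.prod (lambertNoise (Fin 3)))
        {p | k + lambertCount (Torus.geometry (Fin 3)) (hsDiameter σ N) p.2 p.1 s ≤
          lambertCount (Torus.geometry (Fin 3)) (hsDiameter σ N) p.2 p.1 (s + h)} =
      ((((P.prod (lambertNoise (Fin 3))).map
          (fun p => lambertFlow (Torus.geometry (Fin 3)) (hsDiameter σ N) p.2 p.1 s))).prod (lambertNoise (Fin 3)))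
        {q | k ≤ lambertCount (Torus.geometry (Fin 3)) (hsDiameter σ N) q.2 q.1 h} := by
  intro σ hσ hσ' N P _ hP s h hs hh k
  have hε' : hsDiameter σ N < 2⁻¹ := (hsDiameter_le hσ.le N).trans_lt hσ'
  have hA : MeasurableSet {q : Config (N + 1) (Fin 3) T3 × (ℕ → V3) |
      k ≤ lambertCount (Torus.geometry (Fin 3)) (hsDiameter σ N) q.2 q.1 h} :=
    measurableSet_le measurable_const
      (measurable_lambertCount (Torus.isHardSphereRegular_geometry hε') Torus.isMeasurable_geometry h)
  rw [measure_congr (setOf_window_ae_eq_preimage_restart hσ hσ' N P hP hs hh k),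
    ← Measure.map_apply (measurable_lambertRestart hσ.le hσ' N s) hA, map_lambertRestart_eq hσ hσ' N P hP hs]

/-- **E1. Stationarity in law of the window increments of the collision count at equilibrium**
(registered sub-goal `lambertCount_increment_law` of stmt-11854).  For `0 < σ < 1/2`, every `N`,
constant profiles `b, ϑ > 0`, `w`, every flow `Φ` fixing the phase space, `s, h ≥ 0` and `k : ℕ`, under
`μ := G_N ⊗ γ^ℕ` (`G_N = localGibbsLaw σ b w ϑ N Φ`): `μ {k + K_s ≤ K_{s+h}} = μ {k ≤ K_h}` — the number
of Lambertian collisions in the window `(s, s + h]` has the law of the number in `(0, h]`.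
Proof: `measure_setOf_window_eq_map` (cocycle a.e. + strong Markov in law, `G_N ≪ liouville` finite),
then `Λ`-invariance of the Gibbs law `gibbsInvarianceLambda_holds`. [folklore] -/
theorem lambertCount_increment_law :
    ∀ {σ : ℝ}, 0 < σ → σ < 2⁻¹ → ∀ (N : ℕ) (b ϑ : ℝ) (w : V3), 0 < b → 0 < ϑ →
      ∀ (Φ : HardSphereFlow (Torus.geometry (Fin 3)) (hsDiameter σ N) (N + 1)) (s h : ℝ), 0 ≤ s → 0 ≤ h → ∀ k : ℕ,
        ((localGibbsLaw σ (fun _ => b) (fun _ => w) (fun _ => ϑ) N Φ).prod (lambertNoise (Fin 3)))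
            {p | k + lambertCount (Torus.geometry (Fin 3)) (hsDiameter σ N) p.2 p.1 s ≤
                lambertCount (Torus.geometry (Fin 3)) (hsDiameter σ N) p.2 p.1 (s + h)} =
          ((localGibbsLaw σ (fun _ => b) (fun _ => w) (fun _ => ϑ) N Φ).prod (lambertNoise (Fin 3)))
            {p | k ≤ lambertCount (Torus.geometry (Fin 3)) (hsDiameter σ N) p.2 p.1 h} := by
  intro σ hσ hσ' N b ϑ w hb hϑ Φ s h hs hh k
  haveI := isProbabilityMeasure_localGibbsLaw_const hσ' N w hb hϑ Φ
  rw [measure_setOf_window_eq_map hσ hσ' N _ (localGibbsLaw_absolutelyContinuous σ _ _ _ N Φ) hs hh k,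
    gibbsInvarianceLambda_holds σ hσ hσ' N b ϑ w hb hϑ Φ s hs]

end Summit.AtomisticToContinuum.HydrodynamicLimit.Theorems.LambertianContactSwapLambertianEulerEquilibriumCountStationarity

end
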